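/-
Copyright (c) 2026 The abc-iut branch. All rights reserved.
Released under Apache 2.0 license as described in the file LICENSE.
-/
import Summits.ABC.IUTFork.Repair.Barrier28
import Summits.ABC.IUTFork.Repair.CandInternal2TightCells
import Summits.ABC.IUTFork.Repair.CandInternal2TightHeightCells
import HarnessLib

/-!
# Repair/Barrier33 — THE k3 CERTIFICATE INSTANTIATED: the R-H anchor pair RP-I05 ∧ RP-I06⋆ reads the q-pilot's scale (kernel)

LADDER-ABC:A2.RP, BARRIER track (abc-iut-rp-bar, gen 4), in service of D-0079 R-H («LOCAL-HEIGHT CONDITION I06⋆», lead abc-iut-rh-lead), whose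
critic (k3) is the barrier screen `plan/repair/bar/BARRIER-SCREEN.md` and whose kernel door is `Repair.k3_pass_certificate` (Barrier28).

WHAT THIS FILE ADDS. `k3_pass_certificate` is typed over hypothesis SCHEMAS `H : Cand = ∀ T F P ρ qK, Prop`. Every R-H candidate of SCHEMA form is
read at level H JOINTLY with the (Ind3) container hypothesis RP-I05 (`CandInternal2.HInd3Hull`) — the k2 door of record is a sandwich
`QPinned → HInd3Hull → H⋆ → Licence`. §1 packages this once and for all: from a k2 glue theorem of that shape and ONE positive cell of `H⋆` on the
bed family TIGHT(e⃗) (`CandInternal2Tight.tightSetting p e`, any `e⃗` with `e 1 = 0 ∧ e 2 ≤ 3`, where RP-I05 holds by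
`CandInternal2Tight.hInd3Hull_tight_iff`) or TIGHT-HEIGHT(h, e⃗) (`e 1 = 0 ∧ e 2 ≤ 3h`, `CandInternal2TightHeight.hInd3Hull_tightH_iff`), the PAIR
schema `RP-I05 ∧ H⋆` is `SufficientH`, holds at that bed, and is therefore NEITHER shell-blind (`¬ QShellInvariant`) NOR scale-blind (`¬ QScaleInvariant`):
it READS the q-pilot's Kummer image beyond its (Ind3) log-shell container — exactly what the A2.RP barrier (`Repair.a2rp_barrier`) says any level-H
repair must do. §2 instantiates it on the ANCHOR of the R-H search, `H⋆ := RP-I06⋆` (`CandInternal11Gap.HQShellOrbitStar`, k2 glue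
`CandInternal11Gap.licence_of_star`, positive cell `CandInternal2Tight.star_tight_iff` at the threshold vector `e 2 = 3`, and on TIGHT-HEIGHT at
`e 2 = 3h` by `CandInternal2TightHeight.star_tightH_iff`): the pair RP-I05 ∧ RP-I06⋆ is scale- and shell-SENSITIVE in kernel. Every R-H row is a cut /
re-windowing of this anchor; rows typed in NUMERIC (window-table) form get their k3 cell from the screen's decision rule, rows typed in schema form get
it from §1 with their own two named facts.

Honest framing: candidates are HYPOTHESES (`@[claim "Mochizuki2012" "disputed"]` predicates of other files), never asserted; nothing here takes a side on
[IUTchIII] Cor. 3.12 or on any author; typed ≠ proved; no new `Prop` facts; axioms {propext, Classical.choice, Quot.sound}.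
[cite: ScholzeStix2018, §2.2 pp. 9–10 — the scale objection the barrier formalises]
-/

section

open Set

namespace Summit.ABC.IUTFork.Repair

open Thm311 Cor312 Cor312Vol Literature.IUT.LogThetaLattice Cor312.Checks Cor312.IdentifiedNonVacuity
open Cor312Vol.PinnedWitness CandInternal2 CandInternal11Gap
open CandMochizuki6Vocabulary (Cand)

/-! ## 1. The pair schema RP-I05 ∧ H⋆ from a k2 sandwich and one positive TIGHT / TIGHT-HEIGHT cell -/

section Pair

variable (X : ∀ {T : ThetaIndex} (S : LatticeSituation T) (P : Cor312.Setting S.toSituation)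
    (_ρ : (∀ v : T.V, v ∈ T.Vbad → Set (S.L.StarPacket v)) → ∀ (j : T.Label) (vQ : T.VQ), Set (S.L.Packet j vQ))
    (_qK : ∀ v : T.V, v ∈ T.Vbad → Set (S.L.StarPacket v)), Prop)

/-- **k2 ⟹ `SufficientH` for the pair.** If `H⋆ = X` has a k2 glue theorem of the door-of-record shape `QPinned → RP-I05 → H⋆ → Licence`, then the
pair schema `RP-I05 ∧ H⋆` supplies the hull licence under the premises of record and the three pins (the q-pin is the second pin). [folklore] -/
theorem sufficientH_pair_of_k2
    (hk2 : ∀ {T : ThetaIndex} (S : LatticeSituation T) (P : Cor312.Setting S.toSituation)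
      (ρ : (∀ v : T.V, v ∈ T.Vbad → Set (S.L.StarPacket v)) → ∀ (j : T.Label) (vQ : T.VQ), Set (S.L.Packet j vQ))
      (qK : ∀ v : T.V, v ∈ T.Vbad → Set (S.L.StarPacket v)), QPinned S P ρ qK → HInd3Hull S P ρ → X S P ρ qK → Thm311ToCor312.Licence P) :
    SufficientH (fun _ F P ρ qK => HInd3Hull F.toLatticeSituation P ρ ∧ X F.toLatticeSituation P ρ qK) :=
  fun _ F P ρ qK _ _ _ _ _ hpin hH => hk2 F.toLatticeSituation P ρ qK hpin.1.2 hH.1 hH.2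

/-- **THE k3 CERTIFICATE FROM TWO NAMED FACTS (TIGHT).** A k2 glue theorem for `H⋆` and ONE positive cell of `H⋆` on TIGHT(e⃗) inside RP-I05's window
(`e 1 = 0`, `e 2 ≤ 3`) make the pair `RP-I05 ∧ H⋆` shell-SENSITIVE and scale-SENSITIVE. [folklore] -/
theorem k3_certificate_pair_tight (p : ℕ) [Fact p.Prime] (e : Checks.toyIndex.Label → ℕ) (he : e 1 = 0 ∧ e 2 ≤ 3)
    (hk2 : ∀ {T : ThetaIndex} (S : LatticeSituation T) (P : Cor312.Setting S.toSituation)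
      (ρ : (∀ v : T.V, v ∈ T.Vbad → Set (S.L.StarPacket v)) → ∀ (j : T.Label) (vQ : T.VQ), Set (S.L.Packet j vQ))
      (qK : ∀ v : T.V, v ∈ T.Vbad → Set (S.L.StarPacket v)), QPinned S P ρ qK → HInd3Hull S P ρ → X S P ρ qK → Thm311ToCor312.Licence P)
    (hX : X (CandInternal2Tight.tightFull p e).toLatticeSituation (CandInternal2Tight.tightSetting p e) (orbitRegion p) (qDatum p)) :
    ¬ QShellInvariant (fun _ F P ρ qK => HInd3Hull F.toLatticeSituation P ρ ∧ X F.toLatticeSituation P ρ qK) ∧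
      ¬ QScaleInvariant (fun _ F P ρ qK => HInd3Hull F.toLatticeSituation P ρ ∧ X F.toLatticeSituation P ρ qK) :=
  k3_pass_certificate p 1 Nat.one_pos e (Or.inr (Or.inl ⟨(CandInternal2Tight.hInd3Hull_tight_iff p e).2 he, hX⟩))
    (Or.inl (sufficientH_pair_of_k2 X hk2))

/-- **THE k3 CERTIFICATE FROM TWO NAMED FACTS (TIGHT-HEIGHT, every height `h ≥ 1`).** The same with the positive cell on TIGHT-HEIGHT(h, e⃗) inside
RP-I05's window `e 1 = 0`, `e 2 ≤ 3h` — the beds on which the R-H window rows (`H > 1`) live. [folklore] -/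
theorem k3_certificate_pair_tightH (p : ℕ) [Fact p.Prime] (h : ℕ) (hh : 0 < h) (e : Checks.toyIndex.Label → ℕ)
    (he : e 1 = 0 ∧ e 2 ≤ 3 * h)
    (hk2 : ∀ {T : ThetaIndex} (S : LatticeSituation T) (P : Cor312.Setting S.toSituation)
      (ρ : (∀ v : T.V, v ∈ T.Vbad → Set (S.L.StarPacket v)) → ∀ (j : T.Label) (vQ : T.VQ), Set (S.L.Packet j vQ))
      (qK : ∀ v : T.V, v ∈ T.Vbad → Set (S.L.StarPacket v)), QPinned S P ρ qK → HInd3Hull S P ρ → X S P ρ qK → Thm311ToCor312.Licence P)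
    (hX : X (CandInternal2TightHeight.tightHFull p h e).toLatticeSituation (CandInternal2TightHeight.tightHSetting p h e) (orbitRegion p)
      (ProfileHeight.qDatumH p h)) :
    ¬ QShellInvariant (fun _ F P ρ qK => HInd3Hull F.toLatticeSituation P ρ ∧ X F.toLatticeSituation P ρ qK) ∧
      ¬ QScaleInvariant (fun _ F P ρ qK => HInd3Hull F.toLatticeSituation P ρ ∧ X F.toLatticeSituation P ρ qK) :=
  k3_pass_certificate p h hh e
    (Or.inr (Or.inr (Or.inl ⟨(CandInternal2TightHeight.hInd3Hull_tightH_iff p h e).2 he, hX⟩)))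
    (Or.inl (sufficientH_pair_of_k2 X hk2))

end Pair

/-! ## 2. The anchor: RP-I05 ∧ RP-I06⋆ is scale- and shell-sensitive -/

/-- RP-I06⋆'s k2 glue is abc-iut-w5's `CandInternal11Gap.licence_of_star`; hence the anchor pair is `SufficientH`. [folklore] -/
theorem sufficientH_i05_and_i06star :
    SufficientH (fun _ F P ρ qK => HInd3Hull F.toLatticeSituation P ρ ∧ HQShellOrbitStar F.toLatticeSituation P ρ qK) :=
  sufficientH_pair_of_k2 HQShellOrbitStar fun S P ρ qK hq hA h => licence_of_star S P ρ qK hq hA h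

/-- The anchor pair HOLDS at the threshold bed TIGHT(e⃗) with `e 1 = 0`, `e 2 = 3` (index `(2²−1)·ord(q)` at the binding label). [folklore] -/
theorem i05_and_i06star_holds_tight (p : ℕ) [Fact p.Prime] (e : Checks.toyIndex.Label → ℕ) (he : e 1 = 0 ∧ e 2 = 3) :
    HInd3Hull (CandInternal2Tight.tightFull p e).toLatticeSituation (CandInternal2Tight.tightSetting p e) (orbitRegion p) ∧
      HQShellOrbitStar (CandInternal2Tight.tightFull p e).toLatticeSituation (CandInternal2Tight.tightSetting p e) (orbitRegion p)
        (qDatum p) :=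
  ⟨(CandInternal2Tight.hInd3Hull_tight_iff p e).2 ⟨he.1, he.2.le⟩, (CandInternal2Tight.star_tight_iff p e).2 he.2.ge⟩

/-- The anchor pair HOLDS at TIGHT-HEIGHT(h, e⃗) with `e 1 = 0`, `e 2 = 3h`, every `h ≥ 1`. [folklore] -/
theorem i05_and_i06star_holds_tightH (p : ℕ) [Fact p.Prime] (h : ℕ) (e : Checks.toyIndex.Label → ℕ) (he : e 1 = 0 ∧ e 2 = 3 * h) :
    HInd3Hull (CandInternal2TightHeight.tightHFull p h e).toLatticeSituation (CandInternal2TightHeight.tightHSetting p h e) (orbitRegion p) ∧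
      HQShellOrbitStar (CandInternal2TightHeight.tightHFull p h e).toLatticeSituation (CandInternal2TightHeight.tightHSetting p h e)
        (orbitRegion p) (ProfileHeight.qDatumH p h) :=
  ⟨(CandInternal2TightHeight.hInd3Hull_tightH_iff p h e).2 ⟨he.1, he.2.le⟩, (CandInternal2TightHeight.star_tightH_iff p h e).2 he.2.ge⟩

/-- **THE ANCHOR OF R-H PASSES k3 IN KERNEL.** The pair RP-I05 ∧ RP-I06⋆ — the hypothesis every R-H candidate cuts or re-windows — is NEITHER
shell-blind NOR scale-blind: it reads the q-pilot's Kummer image beyond its (Ind3) log-shell container, as `Repair.a2rp_barrier` requires of any level-H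
repair. (Witness move: the one-step expanding q-rescaling at the threshold bed TIGHT(0,0,3), `Repair.tight_expandingMove`.) [folklore] -/
theorem i05_and_i06star_scaleSensitive (p : ℕ) [Fact p.Prime] :
    ¬ QShellInvariant (fun _ F P ρ qK => HInd3Hull F.toLatticeSituation P ρ ∧ HQShellOrbitStar F.toLatticeSituation P ρ qK) ∧
      ¬ QScaleInvariant (fun _ F P ρ qK => HInd3Hull F.toLatticeSituation P ρ ∧ HQShellOrbitStar F.toLatticeSituation P ρ qK) :=
  k3_certificate_pair_tight HQShellOrbitStar p (fun j => if j = 2 then 3 else 0) ⟨by decide, by simp⟩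
    (fun S P ρ qK hq hA h => licence_of_star S P ρ qK hq hA h)
    ((i05_and_i06star_holds_tight p _ ⟨by decide, by simp⟩).2)

/-- The same certificate issued from the TIGHT-HEIGHT cell at every height `h ≥ 1` (the window beds of the R-H rows). [folklore] -/
theorem i05_and_i06star_scaleSensitive_tightH (p : ℕ) [Fact p.Prime] (h : ℕ) (hh : 0 < h) :
    ¬ QShellInvariant (fun _ F P ρ qK => HInd3Hull F.toLatticeSituation P ρ ∧ HQShellOrbitStar F.toLatticeSituation P ρ qK) ∧
      ¬ QScaleInvariant (fun _ F P ρ qK => HInd3Hull F.toLatticeSituation P ρ ∧ HQShellOrbitStar F.toLatticeSituation P ρ qK) :=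
  k3_certificate_pair_tightH HQShellOrbitStar p h hh (fun j => if j = 2 then 3 * h else 0) ⟨by simp, by simp⟩
    (fun S P ρ qK hq hA h => licence_of_star S P ρ qK hq hA h)
    ((i05_and_i06star_holds_tightH p h _ ⟨by simp, by simp⟩).2)

end Summit.ABC.IUTFork.Repair

end
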